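import Mathlib.NumberTheory.ArithmeticFunction.Liouville
import Mathlib.Algebra.Order.BigOperators.Ring.Finset
import Mathlib.Algebra.BigOperators.Field
import Mathlib.Data.Real.Basic
import Mathlib.Data.Nat.Prime.Basic
import Mathlib.Order.Interval.Finset.Nat
import Literature.NumberTheory.LFunctions.LiouvilleSumClassicalBound
import HarnessLib

/-!
# Odd-order logarithmic Chowla (Tao–Teräväinen 2018): notation

Topic `Literature/NumberTheory/Sieve`; notation file for the support files towards the named fact
`Literature.NumberTheory.Sieve.liouville_logCorrelation_isLittleO_of_odd` (**parity.S22**,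
`ParityWave0.lean`), after T. Tao, J. Teräväinen, *Odd order cases of the logarithmically
averaged Chowla conjecture*, J. Théor. Nombres Bordeaux 30 (2018), 997–1015 (arXiv:1710.02112),
§§2–3. Four definitions with bodies and their unfolding / boundedness lemmas; no named facts.
(`|λ| ≤ 1` is taken from `LiouvilleSumClassicalBound.lean`, whose prime number theorem for `λ`
the later files of this series use anyway.)

* `OddLogChowla.dilatedCorr h a n = ∏_i λ(n + a hᵢ)` — the integrand of the quantity
  `f_x(a) = 𝔼^{log}_{n ≤ x} λ(a₁ n + a b₁) ⋯ λ(a_k n + a b_k)` of (3.1) there ("(fax)"), in the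
  case `aᵢ = 1`, `bᵢ = hᵢ ∈ ℕ` of the fact (real-valued);
* `OddLogChowla.setLogAvg S F = (∑_{n ∈ S} F(n)/n) / (∑_{n ∈ S} 1/n)` — the logarithmic average
  `𝔼^{log}_{n ∈ A} f(n)` of §2 over a finite set of natural numbers (for `A` a set of primes this
  is the paper's `𝔼^{log}_{p ∈ A}`; junk value `0` for `S = ∅`, as in the paper's remark that
  the average "may be undefined if `A` contains no primes");
* `OddLogChowla.corrLogAvg h x a = setLogAvg (Icc 1 x) (dilatedCorr h a)` — `f_x(a)` itself, along
  `x ∈ ℕ` (so that `f_x(1) · ∑_{n ≤ x} 1/n` is literally the sum in the fact);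
* `OddLogChowla.dyadicPrimes m` — the primes of the dyadic block `(2^m, 2^{m+1}]`, over which
  Theorems 3.1 and 3.2 average.

## References
* T. Tao, J. Teräväinen, J. Théor. Nombres Bordeaux 30 (2018), §2 (notation `𝔼^{log}`), §3
  ((3.1) = (fax), Theorems 3.1, 3.2). [TaoTeravainenJTNB2018]
-/

open Finset

namespace Literature.NumberTheory.Sieve

namespace OddLogChowla

/-- The dilated Liouville correlation `g_a(n) = ∏ᵢ λ(n + a hᵢ)`, the integrand of
`f_x(a) = 𝔼^{log}_{n ≤ x} ∏ᵢ λ(n + a hᵢ)` (Tao–Teräväinen 2018, (3.1), case `aᵢ = 1`, `bᵢ = hᵢ`),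
as a real number. [cite: TaoTeravainenJTNB2018, §3 (3.1)] -/
def dilatedCorr {k : ℕ} (h : Fin k → ℕ) (a n : ℕ) : ℝ :=
  ∏ i, (ArithmeticFunction.liouville (n + a * h i) : ℝ)

/-- The logarithmic average `𝔼^{log}_{n ∈ S} F(n) = (∑_{n ∈ S} F(n)/n) / (∑_{n ∈ S} 1/n)` over a
finite set of natural numbers (`0` if `S = ∅`). [cite: TaoTeravainenJTNB2018, §2] -/
noncomputable def setLogAvg (S : Finset ℕ) (F : ℕ → ℝ) : ℝ :=
  (∑ n ∈ S, F n / n) / ∑ n ∈ S, (1 : ℝ) / n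

/-- The primes of the dyadic block `(2^m, 2^{m+1}]`. [cite: TaoTeravainenJTNB2018, Theorem 3.1] -/
def dyadicPrimes (m : ℕ) : Finset ℕ :=
  (Finset.Ioc (2 ^ m) (2 ^ (m + 1))).filter Nat.Prime

/-- `f_x(a) = 𝔼^{log}_{n ≤ x} ∏ᵢ λ(n + a hᵢ) = (∑_{n ≤ x} g_a(n)/n) / (∑_{n ≤ x} 1/n)`, the quantity
(3.1) of Tao–Teräväinen 2018 in the case `aᵢ = 1`, `bᵢ = hᵢ`, along `x ∈ ℕ`.
[cite: TaoTeravainenJTNB2018, §3 (3.1)] -/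
noncomputable def corrLogAvg {k : ℕ} (h : Fin k → ℕ) (x a : ℕ) : ℝ :=
  setLogAvg (Finset.Icc 1 x) (dilatedCorr h a)

/-- Unfolding `dilatedCorr`. [folklore] -/
theorem dilatedCorr_def {k : ℕ} (h : Fin k → ℕ) (a n : ℕ) :
    dilatedCorr h a n = ∏ i, (ArithmeticFunction.liouville (n + a * h i) : ℝ) := rfl

/-- Unfolding `setLogAvg`. [folklore] -/
theorem setLogAvg_def (S : Finset ℕ) (F : ℕ → ℝ) :
    setLogAvg S F = (∑ n ∈ S, F n / n) / ∑ n ∈ S, (1 : ℝ) / n := rfl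

/-- Unfolding `corrLogAvg`. [folklore] -/
theorem corrLogAvg_def {k : ℕ} (h : Fin k → ℕ) (x a : ℕ) :
    corrLogAvg h x a = setLogAvg (Finset.Icc 1 x) (dilatedCorr h a) := rfl

/-- Membership in `dyadicPrimes m`. [folklore] -/
theorem mem_dyadicPrimes {m p : ℕ} :
    p ∈ dyadicPrimes m ↔ (2 ^ m < p ∧ p ≤ 2 ^ (m + 1)) ∧ p.Prime := by
  simp [dyadicPrimes]

/-- `|g_a(n)| ≤ 1`. [folklore] -/
theorem abs_dilatedCorr_le_one {k : ℕ} (h : Fin k → ℕ) (a n : ℕ) : |dilatedCorr h a n| ≤ 1 := by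
  rw [dilatedCorr, Finset.abs_prod]
  exact Finset.prod_le_one (fun _ _ => abs_nonneg _) fun i _ =>
    Literature.NumberTheory.LFunctions.LiouvilleSum.abs_liouville_le_one _

/-- The weights of a logarithmic average are nonnegative: `∑_{n ∈ S} 1/n ≥ 0`. [folklore] -/
theorem harmonicWeight_nonneg (S : Finset ℕ) : 0 ≤ ∑ n ∈ S, (1 : ℝ) / n :=
  Finset.sum_nonneg fun n _ => by positivity

/-- A logarithmic average of a `C`-bounded function is `C`-bounded (`C ≥ 0`). [folklore] -/
theorem abs_setLogAvg_le {S : Finset ℕ} {F : ℕ → ℝ} {C : ℝ} (hC : 0 ≤ C)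
    (hF : ∀ n ∈ S, |F n| ≤ C) : |setLogAvg S F| ≤ C := by
  rw [setLogAvg]
  rcases (harmonicWeight_nonneg S).eq_or_lt with h0 | hpos
  · rw [← h0, div_zero, abs_zero]; exact hC
  rw [abs_div, abs_of_pos hpos, div_le_iff₀ hpos, Finset.mul_sum]
  refine (Finset.abs_sum_le_sum_abs _ _).trans (Finset.sum_le_sum fun n hn => ?_)
  rw [abs_div, Nat.abs_cast, mul_one_div]
  exact div_le_div_of_nonneg_right (hF n hn) (Nat.cast_nonneg _)

/-- `|f_x(a)| ≤ 1`. [folklore] -/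
theorem abs_corrLogAvg_le_one {k : ℕ} (h : Fin k → ℕ) (x a : ℕ) : |corrLogAvg h x a| ≤ 1 :=
  abs_setLogAvg_le zero_le_one fun n _ => abs_dilatedCorr_le_one h a n

/-- Linearity of logarithmic averages: `𝔼^{log}(F - G) = 𝔼^{log} F - 𝔼^{log} G`. [folklore] -/
theorem setLogAvg_sub (S : Finset ℕ) (F G : ℕ → ℝ) :
    setLogAvg S (fun n => F n - G n) = setLogAvg S F - setLogAvg S G := by
  simp only [setLogAvg, sub_div, Finset.sum_sub_distrib]

/-- `𝔼^{log}` of a constant is that constant once the weight `∑_{n ∈ S} 1/n` is positive.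
[folklore] -/
theorem setLogAvg_const {S : Finset ℕ} (hS : 0 < ∑ n ∈ S, (1 : ℝ) / n) (c : ℝ) :
    setLogAvg S (fun _ => c) = c := by
  have h1 : ∑ n ∈ S, c / (n : ℝ) = c * ∑ n ∈ S, (1 : ℝ) / n := by
    rw [Finset.mul_sum]
    exact Finset.sum_congr rfl fun n _ => by ring
  rw [setLogAvg, h1, mul_div_assoc, div_self hS.ne', mul_one]

end OddLogChowla

end Literature.NumberTheory.Sieve
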